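import Summits.CriticalPhenomena.CardyFormulaZ2.Theorems.CardyAnchoredRigidityCardyShadowIsolatedStubDilationFlow
import Summits.CriticalPhenomena.CardyFormulaZ2.Theorems.CardyAnchoredRigiditySubseqCardySplit
import Literature.Dynamics.TopologicalDynamics.UniformRecurrence

/-!
# A uniformly recurrent joint sublimit exists (crux `SubseqCardy`, stmt-CriticalPhenomena-5768,
# strategist line `recurrent`: Birkhoff selection on the dilation flow of `Λ'`)

Route `CardyAnchoredRigidity` (decl shared with `CardyLocalRigidity`), sub-problem `CardyFormulaZ2`.
The cluster set `Λ' = clusterSet` of the bond-`ℤ²` crossing-function path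
`δ ↦ (R ↦ bondDomainCrossingProb R δ)` (product topology on `ConformalRectangle → ℝ`) is compact
(`isCompact_clusterSet`: closed, inside `[0,1]^ConformalRectangle`), nonempty (`clusterSet_nonempty`:
the proved joint precompactness `jointSubseqLimit` + `clusterPt_iff_jointLimit`) and invariant under
the scale action `scaleAct s g = (R ↦ g (e^s • R))` (`scaleAct_mem_clusterSet`, exact lattice scale
covariance). Birkhoff's recurrence theorem (tree: `Literature.Dynamics.TopologicalDynamics.
exists_isUniformlyRecurrentPt`, Furstenberg 1981 Thm. 1.16) therefore SELECTS a joint sequential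
limit `g ∈ Λ'` that is UNIFORMLY RECURRENT under dilations: for every finite set of conformal
rectangles and every `ε > 0` the log-scales `s` with `|g (e^s • R) - g R| < ε` form a syndetic
(relatively dense) subset of `ℝ` (`exists_uniformlyRecurrent_clusterPt`, registered one-line form `birkhoffSelection`;
sequential form `exists_uniformlyRecurrent_jointLimit`).

This is the free first step of the strategist's line `recurrent` for the crux: the remaining steps
are the registered stubs `stub_recurrent_isFixed` (a uniformly recurrent point of the dilation flow on
`Λ'` is a fixed point — no RG limit cycle / quasi-periodic RG in bond-`ℤ²` crossing data),
`stub_fixed_conformal` (a scale-fixed joint sublimit is conformally invariant) and `SubseqRigidity`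
(stmt-8271); see `Cruxes/SubseqCardy/Lines/recurrent.lean`. Also recorded: a scale-FIXED cluster
point is trivially uniformly recurrent (`isUniformlyRecurrentPt_of_fixed`), and the composition of the
two symmetry stubs into the strategist's split child `ConformalSublimit`
(`conformalSublimit_of_fixed_conformal`).

References: H. Furstenberg, *Recurrence in Ergodic Theory and Combinatorial Number Theory* (1981),
Ch. 1 §4, Thm. 1.16; O. Schramm, S. Smirnov, Ann. Probab. 39 (2011) §1.3 (dilations act on
subsequential limits).
-/

noncomputable section

namespace Summit.CriticalPhenomena.CardyFormulaZ2.Cruxes.SubseqCardy.Recurrent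

open Set Filter Topology
open Literature.Probability.RandomPlanarGeometry (ConformalRectangle)
open Literature.Probability.Percolation (bondDomainCrossingProb bondDomainCrossingProb_mem_Icc)
open Literature.Dynamics.TopologicalDynamics (IsUniformlyRecurrentPt exists_isUniformlyRecurrentPt
  isUniformlyRecurrentPt_of_forall_eq)
open Summit.CriticalPhenomena.CardyFormulaZ2.Theorems.CardyShadowIsolated.DilationDynamics
  (clusterSet scaleAct scaleAct_mem_clusterSet continuous_scaleAct scaleAct_zero scaleAct_add)
open Summit.CriticalPhenomena.CardyFormulaZ2.Cruxes.SubseqCardy.Birth (jointSubseqLimit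
  clusterPt_iff_jointLimit)

/-- **`Λ'` is compact** (closed set of cluster points inside the compact cube
`[0,1]^ConformalRectangle`). [folklore] -/
theorem isCompact_clusterSet : IsCompact clusterSet := by
  have hK : IsCompact (Set.pi Set.univ (fun _ : ConformalRectangle => Set.Icc (0 : ℝ) 1)) :=
    isCompact_univ_pi fun _ => isCompact_Icc
  have hpK : ∀ δ : ℝ, (fun R : ConformalRectangle => bondDomainCrossingProb R δ) ∈
      Set.pi Set.univ (fun _ : ConformalRectangle => Set.Icc (0 : ℝ) 1) :=
    fun δ R _ => bondDomainCrossingProb_mem_Icc R δ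
  have hsub : clusterSet ⊆ Set.pi Set.univ (fun _ : ConformalRectangle => Set.Icc (0 : ℝ) 1) :=
    fun g hg => hK.isClosed.mem_of_mapClusterPt hg (Eventually.of_forall hpK)
  exact hK.of_isClosed_subset isClosed_setOf_clusterPt hsub

/-- **`Λ'` is nonempty** (joint precompactness of the crossing functions, proved in the tree).
[folklore] -/
theorem clusterSet_nonempty : clusterSet.Nonempty := by
  obtain ⟨u, hu, g, hg⟩ := jointSubseqLimit
  exact ⟨g, (clusterPt_iff_jointLimit g).2 ⟨u, hu, hg⟩⟩

/-- **Birkhoff selection.** Some joint cluster point of the bond-`ℤ²` crossing-function path is a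
uniformly recurrent point of the scale action: `Λ'` is a nonempty compact scale-invariant set, and
every such set of a continuous action of `(ℝ, +)` carries a uniformly recurrent point.
[cite: Furstenberg1981, Ch. 1 §4, Thm. 1.16] -/
theorem exists_uniformlyRecurrent_clusterPt :
    ∃ g ∈ clusterSet, IsUniformlyRecurrentPt scaleAct g :=
  exists_isUniformlyRecurrentPt (G := ℝ) continuous_scaleAct scaleAct_add isCompact_clusterSet
    clusterSet_nonempty fun s _ hg => scaleAct_mem_clusterSet hg s

/-- A scale-fixed crossing function is (trivially) uniformly recurrent. [folklore] -/
theorem isUniformlyRecurrentPt_of_fixed {g : ConformalRectangle → ℝ} (h : ∀ s : ℝ, scaleAct s g = g) :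
    IsUniformlyRecurrentPt scaleAct g :=
  isUniformlyRecurrentPt_of_forall_eq h

/-- **Registered form of the Birkhoff selection** (first step of line `recurrent`, over tree
declarations only): there is a cluster point `g` of the crossing-function path at `0⁺` such that for
every neighbourhood `U` of `g` in the product topology the set of log-scales `s` with
`(R ↦ g (R.map (dilation s))) ∈ U` is syndetic. [cite: Furstenberg1981, Ch. 1 §4, Thm. 1.16] -/
theorem birkhoffSelection : ∃ g : Literature.Probability.RandomPlanarGeometry.ConformalRectangle → ℝ, MapClusterPt g (nhdsWithin (0 : ℝ) (Set.Ioi 0)) (fun (δ : ℝ) (R : Literature.Probability.RandomPlanarGeometry.ConformalRectangle) => Literature.Probability.Percolation.bondDomainCrossingProb R δ) ∧ Literature.Dynamics.TopologicalDynamics.IsUniformlyRecurrentPt Summit.CriticalPhenomena.CardyFormulaZ2.Theorems.CardyShadowIsolated.DilationDynamics.scaleAct g :=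
  exists_uniformlyRecurrent_clusterPt

/-- **Sequential form.** Along some mesh sequence `u → 0⁺` the crossing probabilities of every
conformal rectangle converge to a crossing function `g` that is uniformly recurrent under
dilations. [cite: Furstenberg1981, Ch. 1 §4, Thm. 1.16] -/
theorem exists_uniformlyRecurrent_jointLimit :
    ∃ u : ℕ → ℝ, Tendsto u atTop (𝓝[>] (0 : ℝ)) ∧ ∃ g : ConformalRectangle → ℝ,
      (∀ R : ConformalRectangle, Tendsto (fun n => bondDomainCrossingProb R (u n)) atTop (𝓝 (g R))) ∧
      IsUniformlyRecurrentPt scaleAct g := by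
  obtain ⟨g, hg, hrec⟩ := exists_uniformlyRecurrent_clusterPt
  obtain ⟨u, hu, hgu⟩ := (clusterPt_iff_jointLimit g).1 hg
  exact ⟨u, hu, g, hgu, hrec⟩

/-- **Composition of the two symmetry stubs of line `recurrent` into the split child
`ConformalSublimit`.** If every uniformly recurrent point of the scale action on `Λ'` is scale-fixed
(`stub_recurrent_isFixed`) and every scale-fixed cluster point is conformally invariant
(`stub_fixed_conformal`), then SOME joint sequential limit of the bond-`ℤ²` crossing probabilities is
conformally invariant (the strategist's child `ConformalSublimit`, in its filed `∃ u, …` form).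
[folklore] -/
theorem conformalSublimit_of_fixed_conformal : (∀ g ∈ Summit.CriticalPhenomena.CardyFormulaZ2.Theorems.CardyShadowIsolated.DilationDynamics.clusterSet, Literature.Dynamics.TopologicalDynamics.IsUniformlyRecurrentPt Summit.CriticalPhenomena.CardyFormulaZ2.Theorems.CardyShadowIsolated.DilationDynamics.scaleAct g → ∀ s : ℝ, Summit.CriticalPhenomena.CardyFormulaZ2.Theorems.CardyShadowIsolated.DilationDynamics.scaleAct s g = g) → (∀ g ∈ Summit.CriticalPhenomena.CardyFormulaZ2.Theorems.CardyShadowIsolated.DilationDynamics.clusterSet, (∀ s : ℝ, Summit.CriticalPhenomena.CardyFormulaZ2.Theorems.CardyShadowIsolated.DilationDynamics.scaleAct s g = g) → ∃ G : ℝ → ℝ, ∀ (R : Literature.Probability.RandomPlanarGeometry.ConformalRectangle) (ψ : Literature.Probability.RandomPlanarGeometry.ConformalEquiv UpperHalfPlane.upperHalfPlaneSet R.carrier) (x : Fin 4 → ℝ), R.IsUniformizing ψ x → g R = G (Literature.Probability.RandomPlanarGeometry.crossRatio x)) → ∃ u : ℕ → ℝ, Filter.Tendsto u Filter.atTop (nhdsWithin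 (0 : ℝ) (Set.Ioi 0)) ∧ ∃ G : ℝ → ℝ, ∀ (R : Literature.Probability.RandomPlanarGeometry.ConformalRectangle) (ψ : Literature.Probability.RandomPlanarGeometry.ConformalEquiv UpperHalfPlane.upperHalfPlaneSet R.carrier) (x : Fin 4 → ℝ), R.IsUniformizing ψ x → Filter.Tendsto (fun n => Literature.Probability.Percolation.bondDomainCrossingProb R (u n)) Filter.atTop (nhds (G (Literature.Probability.RandomPlanarGeometry.crossRatio x))) := by
  intro hfix hconf
  obtain ⟨g, hg, hrec⟩ := exists_uniformlyRecurrent_clusterPt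
  obtain ⟨G, hG⟩ := hconf g hg (hfix g hg hrec)
  exact Split.conformalSublimit_iff_exists_conformal_clusterPt.2 ⟨g, ⟨G, hG⟩, hg⟩

end Summit.CriticalPhenomena.CardyFormulaZ2.Cruxes.SubseqCardy.Recurrent

end
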